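import Summits.KontsevichZagierPeriods.KontsevichZagierPeriods.Theses.ToricCore
import Literature.NumberTheory.Transcendental.KZToricCalculus

/-!
# `ToricKernel` (stmt-KontsevichZagierPeriods-7833, route ToricCore) — line `congruence-words`

Crux-strategist ALTERNATIVE line (registered beside the live birth skeleton `Lines/birth.lean`,
which it does not touch). Crux (verbatim the route decl `…Theses.ToricCore.ToricKernel`):
Conjecture 1 in kernel form on the TORIC SPAN — `∀ c ∈ T, KZ.eval c = 0 → c ∈ KZ.relations`,
`T = KZ.toricSpan` (signed-binomial cells, integrands `P/∏ d_k`; `toricKernel_iff` is `Iff.rfl`).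

## The line: chart onto cubes, subdivide and dilate onto LEVEL-`N` WORDS, decide the kernel level by level

Birth isolates the conjecture strength of the crux on the CUBE normal form (`□ⁿ`, `P/∏ d_k`).
This line pushes the transcendence-free reduction one normal form further, onto the form on
which the motivic theory of cyclotomic multiple zeta values (Deligne–Goncharov, Deligne's bases
for `N ∈ {2,3,4,6,8}`, Racinet's double shuffle and distribution torsor, Zhao's standard
relations) and the tree's own MZV machinery (`MzvKernelInKZ`, `HoffmanSpanInKZ`,
`HoffmanIndependence`, `doubleShuffleInKZ_proof`) literally operate: ITERATED INTEGRALS ON THE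
ORDERED SIMPLEX with level-`N` rational letters. A LEVEL-`N` WORD representation is a
representation `s` of dimension `w` with

* domain the open ordered simplex `Δ_w = {t | (∀ i, 0 < t i) ∧ (∀ i, t i < 1) ∧ StrictAnti t}`
  (token for token the simplex of `LinRedNormalForm.MzvKernelInKZ`), and
* integrand agreeing on `Δ_w` with `q · ∏ᵢ pᵢ(tᵢ) / (tᵢ · (1 − tᵢ^N))`, `q ∈ ℚ`, `pᵢ ∈ ℚ[X]`
  (the level-`N` rational alphabet: `dt/t`, `dt/(1 − t)`, the regular coloured letters
  `tᵏ dt/Φ_d(t)`, `d ∣ N`, and polynomial letters, all as `p(t) dt/(t(1 − t^N))`; absolute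
  convergence is the field `s.integrableOn`, so divergent words simply have no representation).

Every level-`N` word representation is itself TORIC (the simplex is a binomial cell; `tᵢ`,
`1 − tᵢ^N` are signed binomials), so the crux implies each stub of kernel type below — the
harmless direction; the way back is the two reductions. Level `N = 1`: the closure of the
level-`1` words is, modulo `KZ.relations`, the MZV-word span of `LinRedNormalForm.MzvKernelInKZ`
(stmt-3914) plus constants (a polynomial letter is integrated out by Newton–Leibniz with a
POLYNOMIAL primitive — a legitimate rule-(3) instance), so `stub_wordKernel` AT LEVEL 1 is that
existing crux, whose scoping into `HoffmanSpanInKZ` (derivability) ∧ `HoffmanIndependence`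
(Zagier's conjecture) is proved in tree (`Theorems/MzvKernelInKZ/Negative/Transfer.lean`,
`cruxAdm_of_family`, `crux_iff_cruxAdm`).

* `stub_cubeAccessibility` (W1; transcendence-free, size L): every `c ∈ T` is congruent modulo
  `KZ.relations` to an element of the CUBE SPAN `Q` (domain `□ⁿ = {y | ∀ i, 0 < y i ∧ y i < 1}`,
  integrand `P/∏ d_k`, `d_k` signed binomials). This is birth's `stub_fanDecomposition` followed
  by birth's `stub_monomialChart` (coordinate-hyperplane cuts, orthant reflections, triangulation
  of the rational cone `log(cell)` into simplicial cones — moves (1a), (2) —, then ONE integer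
  monomial chart `Φ_A : □ⁿ → Φ_A(□ⁿ)` per simplicial cell, move (2) with Jacobian
  `|det A|·∏ᵢ∏ⱼ yⱼ^{A i j}/∏ⱼ yⱼ`); a proof of birth's S1 and S2 proves it in two lines, and it is
  stated merged so that this line does not duplicate registered stub signatures. Why it might
  fail: only by a defect of the inline encoding (restrictions to semialgebraic pieces,
  `KZ.IntegralRep.restrict`); the polyhedral lemma (triangulation of rational cones) is not in
  Mathlib.
* `stub_coneSubdivision` (W2; transcendence-free, PRIMITIVE-FREE up to rational Stokes, size XL —
  the NEW transcendence-free content of the line): every element of the cube span is congruent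
  modulo `KZ.relations` to an element of the span of level-`N` word representations for ONE level
  `N ≥ 1`. Value-level this is Terasoma's theorem (arXiv:math/0410306, Thm 2.3: zeta values of
  rational convex cones — and the period integrals `∫_□ⁿ y^{c−1}/∏ₖ(1 − y^{b_k})` of the pairs
  `(U; B)` of his introduction — lie in the span of cyclotomic multiple zeta values of all
  levels), whose printed proof is ANALYTIC (differential equations for one-variable functions
  `I(y_n)`), not a chain of moves. Intended move-proof, every step a rule-(1)/(2) instance or a
  rule-(3) instance with a RATIONAL primitive: (i) reduce denominator multiplicities by partial
  fractions in one variable and rational Stokes `∂_y(P/∏(1 − m·y)^e)` (integrand additivity,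
  Newton–Leibniz with rational `F`); (ii) STUFFLE-TYPE partial fractions of the generating function
  `1/∏ₖ(1 − Y_k) = Σ_π (monomial)/∏ᵢ(1 − Y_{π,1}⋯Y_{π,i})` (`Y_k = y^{b_k}`; = Guo–Paycha–Zhang's
  open-cone subdivision of the SUMMATION cone; integrand additivity with positive summands, the
  route's `FiniteStuffleToric` pattern) making the exponent vectors NESTED; (iii) the monomial
  chart to flag coordinates `u_i = y^{β_i}` (rule (2); integer monomial map with `det ≠ 0`, the
  inverse direction of birth's S2) — it lands on a LOG-CONE REGION `{u : u^{m} ≶ u^{m'}}` of the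
  `u`-cube with cubical-MZV denominators `(1 − u₁)(1 − u₁u₂)⋯` and a fractional monomial weight;
  (iv) the cubical-to-simplicial chart `tᵢ = u₁⋯uᵢ` (unimodular, rule (2); landed pattern
  `FurushoPentagon.HoffmanRelationInKZ.monomialChart_transport`) onto a region between monomial
  hypersurfaces INSIDE `Δ_w` with MZV letters `dt/t`, `dt/(1−t)` and weights `t^γ`, `γ ∈ ℚ`;
  (v) STRAIGHTENING AND LEVEL: coordinatewise dilations `tᵢ = τᵢ^{k}` (order-preserving on `Δ_w`,
  rule (2); the dilation moves of routes TerasomaMultiplication / HurwitzMicroSectors) turn a curved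
  face `t_j < t_i^{k}` into the straight face `τ_j < τ_i` and the letter `dt_j/(1 − t_j)` into the
  level-`k` letter `kτ^{k−1}dτ/(1 − τ^k)` — this is exactly how levels arise — and clear the
  denominators of the `γᵢ`; a common level by `1 − t^{NM} = (1 − t^N)Σ_{j<M}t^{Nj}`. In DIMENSION
  ≤ 2 the recursion closes (every face involves two coordinates); worked chain, three rule-(2)
  moves, no cut: `[□², 1/(1 − x²y³)]` →(x = u^{1/2}, y = v^{1/3})→ `[□², u^{−1/2}v^{−2/3}/(6(1 − uv))]`
  →(t₁ = u, t₂ = uv)→ `[Δ₂, t₁^{−5/6}t₂^{−2/3}/(6(1 − t₂))]` →(tᵢ = τᵢ⁶)→ `[Δ₂, 6τ₂/(1 − τ₂⁶)]`, the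
  level-6 word with `q = 6`, `p₁ = X − X⁷`, `p₂ = X²` (value `Σ_ℓ 1/((2ℓ+1)(3ℓ+1))
  = 6∫₀¹τ(1−τ)/(1−τ⁶)dτ = (3/2)log 3 − 2 log 2 + π/(2√3)`, checked by series). The OPEN POINT is
  dimension ≥ 3: a simplicial log-cone region carries monomial inequalities in three or more
  coordinates (of the type `t₂² < t₁t₃`), which no sequence of coordinatewise dilations straightens; there the
  printed argument integrates along a fibre. Why it
  might fail: the rules may be weaker than the motives on this sector (HuberMullerStach2017
  Rem. 13.1.8): step (ii)'s subdivision may not reach simplicial-coordinate denominators for every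
  exponent configuration without an integration along fibres whose primitive is a polylogarithm —
  not ℚ-semialgebraic, the technique class stopped by
  `Literature.Barriers.KontsevichZagierPeriods.noSemialgebraicPrimitive_inv_sub_two`; one cube
  representation provably outside the word span modulo `KZ.relations` would be a rule-weakness
  witness of the shape route Neg looks for (and is itself unprovable today: no invariant of
  `FormalRep ⧸ relations` finer than `eval` is known, Neg item 0309).
* `stub_wordKernel` (W3; conjecture strength — the HARDEST stub, all of the crux's
  period-conjecture strength, now filtered by LEVEL): for every `N ≥ 1`, every `ℤ`-combination of
  level-`N` word representations with value `0` lies in `KZ.relations`. Level 1 = `MzvKernelInKZ`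
  (+ constants); levels `2, 3, 4, 6, 8` admit the same scoping as level 1 into a derivability half
  (Deligne's motivic bases, Deligne2010, realised by moves) and a declared transcendence half
  (ℚ-linear independence of the real Deligne-basis values ⟺ Grothendieck's period conjecture for
  `MT(ℤ[μ_N, 1/N])` in basis form); for general `N` NO explicit basis or complete relation family
  is in print (Zhao2010 §7: "a naive generalization … to all levels does not exist at present";
  Goncharov's modular obstruction at prime level, GoncharovECM2001), so there the stub is the bare
  period conjecture of the sector. Why it might fail: exactly the crux's why-might-fail, level by
  level — false as soon as the four moves miss one motivic relation among level-`N` values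
  (distribution, the non-standard octahedral relations at `N = 4`, Zhao2008) or a non-motivic
  `ℤ`-relation exists; the strength barriers `kzConjecture_implies_oddZetaAlgIndep` (level 1),
  `kzConjecture_implies_twoPiI_log_algIndep` (`π = 3√3·∫_Δ₁dt/(1+t+t²)`… level ≤ 4: `π/4 = ∫_Δ₁ dt/(1+t²)`,
  `log 2 = ∫_Δ₁ dt/(1+t)`) bite here as they bite on the crux — conceded, relocated, not evaded.

Composition `ToricKernel_of : W1-sig → W2-sig → W3-sig → ToricKernel` is sorry-free
(`c = (c − q) + (q − t) + t`, soundness `KZ.relations_le_ker_eval_holds` for `eval t = 0`);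
`toricKernel_skeleton : ToricKernel` feeds the stubs in by name.

Disproof used: none on file (`ledger crux ls stmt-KontsevichZagierPeriods-7833`: `Lines/birth.*`
only; no `Disproof.lean`, no `_false_without_` obligations, no landed
`Theorems/ToricKernel/Negative/*`; negatives index: 1 unrelated entry, KinematicPlaneConvex
stmt-5394) (2026-08-17). STUCK goal of the current line dodged: none recorded (no lead prover has
held the crux; `payload.lead` empty); relative to birth the line replaces the opaque cube kernel
`stub_cubeKernel` by a LEVEL-FILTERED kernel on the normal form where the N = 1 instance is an
existing, analysed crux and the transcendence-free remainder (W2) is a concrete programme of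
rule-(2) instances already exercised elsewhere in the tree (monomial charts, dilations).
-/

set_option linter.dupNamespace false

namespace Summit.KontsevichZagierPeriods.KontsevichZagierPeriods.Cruxes.ToricKernel.CongruenceWords

open scoped BigOperators
open Literature.NumberTheory.Transcendental
open Summit.KontsevichZagierPeriods.KontsevichZagierPeriods.Theses.ToricCore (ToricKernel)

/-- The route's inline toric span `let T := AddSubgroup.closure {…}` is, token for token, the
Literature constant `KZ.toricSpan`, so the crux is the kernel statement on `KZ.toricSpan`
(definitional unfolding). [cite: KontsevichZagier2001, §1.2 Conjecture 1] -/
theorem toricKernel_iff :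
    ToricKernel ↔ ∀ c ∈ KZ.toricSpan, KZ.eval c = 0 → c ∈ KZ.relations := Iff.rfl

/-- **Stub W1 — cube accessibility (transcendence-free, L).** Every element of the toric span is
congruent modulo the KZ relations to a `ℤ`-combination of CUBE representations: domain the open
unit cube `□ⁿ = {y | ∀ i, 0 < y i ∧ y i < 1}`, integrand `P/∏ₖ d_k` on it (`P ∈ ℚ[y]`, `d_k`
signed binomials). Birth's `stub_fanDecomposition` (coordinate cuts, orthant reflections,
triangulation of the rational cone `log(cell)`: moves (1a), (2)) followed by birth's
`stub_monomialChart` (one integer monomial chart `Φ_A`, `det A ≠ 0`, per simplicial cell: move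
(2) with Jacobian `|det A|·∏ᵢ∏ⱼ yⱼ^{A i j}/∏ⱼ yⱼ`); stated merged. Why it might fail: only through
the inline encoding (restrictions of representations to semialgebraic pieces); the triangulation
lemma for rational polyhedral cones is absent from Mathlib.
[cite: GuoPaychaZhang2014, §2–3 (cones, subdivisions, GLₙ(ℤ))] [cite: KontsevichZagier2001, §1.2 rules (1), (2)] -/
theorem stub_cubeAccessibility :
    ∀ c ∈ Literature.NumberTheory.Transcendental.KZ.toricSpan,
      ∃ q ∈ AddSubgroup.closure
        {e : Literature.NumberTheory.Transcendental.KZ.FormalRep | ∃ (n K : ℕ)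
          (r : Literature.NumberTheory.Transcendental.KZ.IntegralRep n)
          (d : Fin K → (Fin n → ℝ) → ℝ) (P : MvPolynomial (Fin n) ℚ),
          r.domain = {y : Fin n → ℝ | ∀ i, 0 < y i ∧ y i < 1} ∧
          (∀ k, Literature.NumberTheory.Transcendental.KZ.IsSignedBinomial (d k)) ∧
          Set.EqOn r.integrand (fun x => MvPolynomial.aeval x P / ∏ k, d k x) r.domain ∧
          e = Literature.NumberTheory.Transcendental.KZ.of r},
      c - q ∈ Literature.NumberTheory.Transcendental.KZ.relations := by
  sorry

/-- **Stub W2 — cone subdivision and dilation onto level-`N` words (transcendence-free,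
primitive-free up to rational Stokes, XL).** Every element of the cube span is congruent modulo
the KZ relations to a `ℤ`-combination of LEVEL-`N` WORD representations for one level `N ≥ 1`:
domain the open ordered simplex `Δ_w`, integrand `q·∏ᵢ pᵢ(tᵢ)/(tᵢ(1 − tᵢ^N))` on it (`q ∈ ℚ`,
`pᵢ ∈ ℚ[X]`). Value-level = Terasoma's theorem (cone zeta values / the toric period integrals
`∫_□ⁿ y^{c−1}/∏(1 − y^{b_k})` are cyclotomic multiple zeta values of some level), printed with an
analytic proof; the move-proof intended here uses only partial fractions and rational Stokes
(denominator multiplicities), stuffle-type partial fractions of the generating function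
(= Guo–Paycha–Zhang open-cone subdivision; nested exponents), the monomial chart to flag
coordinates (a log-cone region with cubical-MZV denominators), the cubical-to-simplicial chart,
and coordinatewise dilations `t = τ^k` that straighten curved faces `t_j < t_i^k` and turn
`dt/(1−t)` into level-`k` letters — rules (1), (2) and rule (3) with rational primitives only;
complete in dimension ≤ 2 (worked chain `[□², 1/(1−x²y³)] ≡ [Δ₂, 6τ₂/(1−τ₂⁶)]` in the module
docstring), open in dimension ≥ 3 (faces in three or more coordinates). Why it might fail: the rules may be weaker
than the motives here (HuberMullerStach2017 Rem. 13.1.8) — some exponent configuration may need an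
integration along fibres with a polylogarithmic (non-semialgebraic) primitive, the class stopped
by `Literature.Barriers.KontsevichZagierPeriods.noSemialgebraicPrimitive_inv_sub_two`.
[cite: Terasoma2002] [cite: GuoPaychaZhang2014, §3] [cite: KontsevichZagier2001, §1.2 rule (2)] -/
theorem stub_coneSubdivision :
    ∀ q ∈ AddSubgroup.closure
        {e : Literature.NumberTheory.Transcendental.KZ.FormalRep | ∃ (n K : ℕ)
          (r : Literature.NumberTheory.Transcendental.KZ.IntegralRep n)
          (d : Fin K → (Fin n → ℝ) → ℝ) (P : MvPolynomial (Fin n) ℚ),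
          r.domain = {y : Fin n → ℝ | ∀ i, 0 < y i ∧ y i < 1} ∧
          (∀ k, Literature.NumberTheory.Transcendental.KZ.IsSignedBinomial (d k)) ∧
          Set.EqOn r.integrand (fun x => MvPolynomial.aeval x P / ∏ k, d k x) r.domain ∧
          e = Literature.NumberTheory.Transcendental.KZ.of r},
      ∃ N : ℕ, 0 < N ∧ ∃ t ∈ AddSubgroup.closure
        {e : Literature.NumberTheory.Transcendental.KZ.FormalRep | ∃ (w : ℕ) (p : Fin w → Polynomial ℚ)
          (q : ℚ) (s : Literature.NumberTheory.Transcendental.KZ.IntegralRep w),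
          s.domain = {t : Fin w → ℝ | (∀ i, 0 < t i) ∧ (∀ i, t i < 1) ∧ StrictAnti t} ∧
          Set.EqOn s.integrand (fun t => (q : ℝ) *
            ∏ i, Polynomial.aeval (t i) (p i) / (t i * (1 - t i ^ N))) s.domain ∧
          e = Literature.NumberTheory.Transcendental.KZ.of s},
      q - t ∈ Literature.NumberTheory.Transcendental.KZ.relations := by
  sorry

/-- **Stub W3 — the kernel on level-`N` words, every level (conjecture strength; the hardest
stub).** For every `N ≥ 1`: every `ℤ`-combination of level-`N` word representations (domain
`Δ_w`, integrand `q·∏ᵢ pᵢ(tᵢ)/(tᵢ(1 − tᵢ^N))`) whose value is `0` lies in `KZ.relations`. Level 1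
is `LinRedNormalForm.MzvKernelInKZ` (+ constants), scoped in tree into `HoffmanSpanInKZ` ∧
`HoffmanIndependence` (`Theorems/MzvKernelInKZ/Negative/Transfer.lean`); levels 2, 3, 4, 6, 8
admit the same scoping over Deligne's bases; for general `N` no basis or complete relation family
is in print (Zhao2010 §7), and the statement is the bare period conjecture of the level-`N`
sector. Why it might fail: the crux's own risk, level by level — one motivic relation among
level-`N` values missed by the four moves (distribution; the non-standard octahedral relations at
`N = 4`) or one non-motivic `ℤ`-relation; the strength barriers
`kzConjecture_implies_oddZetaAlgIndep` / `kzConjecture_implies_twoPiI_log_algIndep` bite here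
(`ζ(s)`, `log 2 = ∫_Δ₁dt/(1+t)`, `π/4 = ∫_Δ₁dt/(1+t²)` are word values of levels 1, 2, 4).
[cite: KontsevichZagier2001, §1.2 Conjecture 1] [cite: Deligne2010] [cite: Zhao2010, §7] [cite: GoncharovECM2001] -/
theorem stub_wordKernel :
    ∀ N : ℕ, 0 < N → ∀ c ∈ AddSubgroup.closure
        {e : Literature.NumberTheory.Transcendental.KZ.FormalRep | ∃ (w : ℕ) (p : Fin w → Polynomial ℚ)
          (q : ℚ) (s : Literature.NumberTheory.Transcendental.KZ.IntegralRep w),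
          s.domain = {t : Fin w → ℝ | (∀ i, 0 < t i) ∧ (∀ i, t i < 1) ∧ StrictAnti t} ∧
          Set.EqOn s.integrand (fun t => (q : ℝ) *
            ∏ i, Polynomial.aeval (t i) (p i) / (t i * (1 - t i ^ N))) s.domain ∧
          e = Literature.NumberTheory.Transcendental.KZ.of s},
      Literature.NumberTheory.Transcendental.KZ.eval c = 0 →
        c ∈ Literature.NumberTheory.Transcendental.KZ.relations := by
  sorry

/-- **Composition** (sorry-free): cube accessibility, cone subdivision onto one level, the kernel
at that level, chained in the free abelian group `KZ.FormalRep` through the soundness of the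
calculus (`KZ.relations_le_ker_eval_holds`): `c = (c − q) + (q − t) + t` with the first two
summands relations, hence `eval t = eval c = 0`. Concludes the route declaration
`…Theses.ToricCore.ToricKernel` by name. [cite: KontsevichZagier2001, §1.2] -/
theorem ToricKernel_of :
    (∀ c ∈ KZ.toricSpan,
      ∃ q ∈ AddSubgroup.closure
        {e : KZ.FormalRep | ∃ (n K : ℕ) (r : KZ.IntegralRep n)
          (d : Fin K → (Fin n → ℝ) → ℝ) (P : MvPolynomial (Fin n) ℚ),
          r.domain = {y : Fin n → ℝ | ∀ i, 0 < y i ∧ y i < 1} ∧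
          (∀ k, KZ.IsSignedBinomial (d k)) ∧
          Set.EqOn r.integrand (fun x => MvPolynomial.aeval x P / ∏ k, d k x) r.domain ∧
          e = KZ.of r},
      c - q ∈ KZ.relations) →
    (∀ q ∈ AddSubgroup.closure
        {e : KZ.FormalRep | ∃ (n K : ℕ) (r : KZ.IntegralRep n)
          (d : Fin K → (Fin n → ℝ) → ℝ) (P : MvPolynomial (Fin n) ℚ),
          r.domain = {y : Fin n → ℝ | ∀ i, 0 < y i ∧ y i < 1} ∧
          (∀ k, KZ.IsSignedBinomial (d k)) ∧
          Set.EqOn r.integrand (fun x => MvPolynomial.aeval x P / ∏ k, d k x) r.domain ∧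
          e = KZ.of r},
      ∃ N : ℕ, 0 < N ∧ ∃ t ∈ AddSubgroup.closure
        {e : KZ.FormalRep | ∃ (w : ℕ) (p : Fin w → Polynomial ℚ) (q : ℚ) (s : KZ.IntegralRep w),
          s.domain = {t : Fin w → ℝ | (∀ i, 0 < t i) ∧ (∀ i, t i < 1) ∧ StrictAnti t} ∧
          Set.EqOn s.integrand (fun t => (q : ℝ) *
            ∏ i, Polynomial.aeval (t i) (p i) / (t i * (1 - t i ^ N))) s.domain ∧
          e = KZ.of s},
      q - t ∈ KZ.relations) →
    (∀ N : ℕ, 0 < N → ∀ c ∈ AddSubgroup.closure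
        {e : KZ.FormalRep | ∃ (w : ℕ) (p : Fin w → Polynomial ℚ) (q : ℚ) (s : KZ.IntegralRep w),
          s.domain = {t : Fin w → ℝ | (∀ i, 0 < t i) ∧ (∀ i, t i < 1) ∧ StrictAnti t} ∧
          Set.EqOn s.integrand (fun t => (q : ℝ) *
            ∏ i, Polynomial.aeval (t i) (p i) / (t i * (1 - t i ^ N))) s.domain ∧
          e = KZ.of s},
      KZ.eval c = 0 → c ∈ KZ.relations) →
    ToricKernel := by
  intro hacc hcone hker
  rw [toricKernel_iff]
  intro c hc h0
  obtain ⟨q, hq, hcq⟩ := hacc c hc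
  obtain ⟨N, hN, t, ht, hqt⟩ := hcone q hq
  -- `c − t = (c − q) + (q − t)` is a relation
  have hct : c - t ∈ KZ.relations := by
    have h := KZ.relations.add_mem hcq hqt
    rwa [sub_add_sub_cancel] at h
  -- soundness: relations evaluate to `0`, so `eval t = eval c = 0`
  have h1 : KZ.eval (c - t) = 0 :=
    (AddMonoidHom.mem_ker).mp (KZ.relations_le_ker_eval_holds hct)
  have ht0 : KZ.eval t = 0 := by
    rwa [map_sub, h0, zero_sub, neg_eq_zero] at h1
  -- the kernel on level-`N` words, then `c = (c − t) + t`
  have h2 := KZ.relations.add_mem hct (hker N hN t ht ht0)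
  rwa [sub_add_cancel] at h2

/-- The by-name skeleton theorem: the three stubs fed into `ToricKernel_of` (its only `sorryAx`
dependencies are `stub_cubeAccessibility`, `stub_coneSubdivision`, `stub_wordKernel`).
[cite: KontsevichZagier2001, §1.2] -/
theorem toricKernel_skeleton : ToricKernel :=
  ToricKernel_of stub_cubeAccessibility stub_coneSubdivision stub_wordKernel

/-- Level `N = 1` letters contain the MZV letters: `1/t = (1 − t)/(t(1 − t))` and
`1/(1 − t) = t/(t(1 − t))` on `0 < t < 1` — the level-1 word span contains the MZV word span of
`LinRedNormalForm.MzvKernelInKZ` generator by generator (sanity check of the encoding). [folklore] -/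
example (t : ℝ) (h0 : 0 < t) (h1 : t < 1) :
    1 / t = Polynomial.aeval t (1 - Polynomial.X : Polynomial ℚ) / (t * (1 - t ^ 1)) ∧
    1 / (1 - t) = Polynomial.aeval t (Polynomial.X : Polynomial ℚ) / (t * (1 - t ^ 1)) := by
  have ht : t ≠ 0 := h0.ne'
  have ht1 : 1 - t ≠ 0 := (sub_pos.mpr h1).ne'
  constructor
  · simp only [map_sub, map_one, Polynomial.aeval_X, pow_one]
    field_simp
  · simp only [Polynomial.aeval_X, pow_one]
    field_simp

/-- A level-`N` letter is a level-`N·M` letter (`0 < t < 1`): `p(t)/(t(1 − t^N)) =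
p(t)·(Σ_{j<M} t^{Nj})/(t(1 − t^{NM}))` — the level filtration is directed, so finitely many word
representations always have a common level (used inside W2). [folklore] -/
example (t : ℝ) (h0 : 0 < t) (h1 : t < 1) (N M : ℕ) (hN : 0 < N) (hM : 0 < M) (a : ℝ) :
    a / (t * (1 - t ^ N)) = a * (∑ j ∈ Finset.range M, (t ^ N) ^ j) / (t * (1 - t ^ (N * M))) := by
  have ht : t ≠ 0 := h0.ne'
  have htN : t ^ N < 1 := pow_lt_one₀ h0.le h1 hN.ne'
  have hN1 : 1 - t ^ N ≠ 0 := (sub_pos.mpr htN).ne'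
  have hNM : 1 - t ^ (N * M) ≠ 0 := by
    have : t ^ (N * M) < 1 := pow_lt_one₀ h0.le h1 (Nat.mul_pos hN hM).ne'
    exact (sub_pos.mpr this).ne'
  have key : (∑ j ∈ Finset.range M, (t ^ N) ^ j) * (1 - t ^ N) = 1 - t ^ (N * M) := by
    rw [geom_sum_mul_neg, ← pow_mul]
  rw [div_eq_div_iff (mul_ne_zero ht hN1) (mul_ne_zero ht hNM), ← key]
  ring

end Summit.KontsevichZagierPeriods.KontsevichZagierPeriods.Cruxes.ToricKernel.CongruenceWords
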